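import Mathlib
import Literature.NumberTheory.LFunctions.Zhang2022.Section13MeanSquaresParams
import HarnessLib

/-!
# Zhang (2022) §13 p. 75, (13.11) «𝓔 = o(𝔓)»: the loss-free mean squares over `ψ` of the SHORT
# Dirichlet-polynomial factors — `B(s,ψ)`, `N(s+β,ψ)B(s,ψ)`, the `E₁`-polynomial times `B`,
# `N(s+β,ψ)N(s+β′,ψ)`, and `N`, `K`, the `E₁`-polynomial alone — on the strip `|Re s − ½| ≤ 2α`

Topic `Literature/NumberTheory/LFunctions/Zhang2022` (Landau–Siegel audit tree; verdict-neutral).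
Y. Zhang, *Discrete mean estimates and the Landau–Siegel zero*, arXiv:2211.02515v1 (2022)
[Zhang2022LandauSiegel], §13 p. 75 (tex L3806–3817): "Combining (2.34), Cauchy's inequality,
Proposition 7.1, Lemma 5.9, 6.1 and 3.3, we can verify that `𝓔 = o(𝔓)` (13.11)" — NOT carried out in
print (plan/GAP-LEDGER G-L3t6-3; lane ZHANG-L WP14, leaf `Skeleton.Eq1311Rel c′ c₀`; companions
`Section13MeanSquareTools`, `Section13MeanSquaresParams`). **An unrefereed manuscript under
adjudication; nothing here asserts its Theorems 1–2.**

Every factor of `E₁*(ρ,ψ)|B(ρ,ψ)|` other than the `L`-values is a Dirichlet polynomial in `ψ` of length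
`≤ P` (`B`: `< PT⁻⁷`; `N`: `2T²`; the `E₁`-polynomial `Σ_{n<T³}ψ(n)n^{−w}`: `T³`; `K`: `2P₄ ≤ P`), and so
are the products `N·B`, `(E₁-poly)·B`, `N·N`. Hence the FIRST assertion of Lemma 3.3
(`meanSq_floorP_le`, scale `𝔓`, no large-sieve loss) bounds their mean squares over any finite `T ⊆ Ψ`,
uniformly on `|Re s − ½| ≤ 2α` and in purely imaginary shifts `β` (`β_j` of (2.13), `β_j + iv` of `E₁`):

* `meanSq_Bpoly_frakP_le` — `Σ_{ψ∈T}|B(s,ψ)|² ≤ C·𝔓·𝓛³⁶`;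
* `meanSq_short_Bpoly_frakP_le` (the engine), `meanSq_Nchar_Bpoly_frakP_le`, `meanSq_E1poly_Bpoly_frakP_le` —
  `Σ|N(s+β,ψ)B(s,ψ)|²`, `Σ|Σ_{n<T³}ψ(n)n^{−(s+β)}·B(s,ψ)|² ≤ C·𝔓·𝓛⁴⁶` (`36` from `τ₂`, `10` from the
  length `T^{O(1)}` of the short factor, `log T ≤ 𝓛²`);
* `meanSq_Nchar_Nchar_frakP_le` — `Σ|N(s+β,ψ)N(s+β′,ψ)|² ≤ C·𝔓·𝓛⁸`;
* `meanSq_short_frakP_le`, `meanSq_Nchar_E1poly_frakP_le` (`≤ C·𝔓·𝓛²`), `meanSq_Kchar_frakP_le` (`≤ C·𝔓·𝓛⁹`).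

Theorem-only; no definitions, no new facts; Assumption (A) is not used.
WHAT THIS IS NOT: any claim about Theorems 1–2 of the manuscript or about Landau–Siegel zeros.

## References

* Y. Zhang, arXiv:2211.02515v1 (2022), §13 p. 75; §3 Lemma 3.3 p. 14; §6 Lemma 6.1 p. 30;
  §15 (15.1)–(15.2) p. 79. [cite: Zhang2022LandauSiegel, §13 (13.11) p.75]
-/

noncomputable section

open Complex Real Finset Filter

namespace Literature.NumberTheory.LFunctions.Zhang2022.Typed.Section13

open Skeleton MeanSquareMajorant Section7Eq75

variable {D : ℕ}

/-! ## C. The mean squares -/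

/-- **`Σ_{ψ∈T} |B(s,ψ)|² ≤ C·𝔓·𝓛³⁶`** on `|Re s − ½| ≤ 2α`, for all large `D` and every finite `T ⊆ Ψ`
(Lemma 3.3 (i): length `PT⁻⁷ ≤ P`; coefficients `bχ ≪ βτ₂`, `Σ_{n≤P}τ₂(n)²/n ≪ (log P)⁴ = 𝓛³⁶`).
[cite: Zhang2022LandauSiegel, §13 p.75; §15 (15.1)–(15.2)] -/
theorem meanSq_Bpoly_frakP_le : ∃ C : ℝ, ∃ D₀ : ℕ, ∀ (D : ℕ) [NeZero D] (χ : DirichletCharacter ℂ D), D₀ ≤ D →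
    ∀ (T : Finset (Chr D)) (s : ℂ), |s.re - 1 / 2| ≤ 2 * alpha D →
      ∑ x ∈ T, ‖Bpoly χ x s‖ ^ 2 ≤ C * frakP D * ell D ^ 36 := by
  obtain ⟨D₁, hD₁⟩ := Filter.eventually_atTop.mp (tendsto_ell_atTop.eventually (eventually_ge_atTop 4))
  set β : ℝ := (1 + ‖iota2‖) * (‖iota3‖ + ‖iota4‖) with hβ
  refine ⟨Real.exp (8 * π) * (β ^ 2 * majorantConst 4 4), D₁, fun D _ χ hD T s hs => ?_⟩
  have hL : 4 ≤ ell D := hD₁ D hD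
  have hL1 : 1 ≤ ell D := by linarith
  obtain ⟨-, ⟨-, -, hlogP⟩, -, ⟨-, -, hlenB⟩⟩ := lengths_of_four_le_ell hL
  obtain ⟨-, -, -, hP2⟩ := sizes_of_four_le_ell hL
  set NB := ⌈bigP D / bigT D ^ 7⌉₊ with hNB
  have hP : 0 ≤ frakP D := by
    rw [frakP_eq_sum_primeWindow]; exact Finset.sum_nonneg fun p _ => Nat.cast_nonneg p
  -- `B` as a polynomial over `1 ≤ n ≤ ⌊P⌋`
  have hB : ∀ x : Chr D, Bpoly χ x s = ∑ n ∈ Icc 1 ⌊bigP D⌋₊,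
      (fun n => if n < NB then bcoef D n * χ (n : ZMod D) else 0) n * x.ψ (n : ZMod x.p) *
        (n : ℂ) ^ (-s) := fun x => by
    rw [Bpoly_eq_dirPoly χ hL x s]; exact sum_Ico_eq_sum_Icc_trunc hlenB _ _ s
  have hdom : Dom (fun n => if n < NB then bcoef D n * χ (n : ZMod D) else 0) β (tau 2) :=
    dom_trunc_of_dom (dom_bcoef_chi χ (by change 2 ≤ ell D; linarith)) (by positivity) (tau_nonneg 2) NB
  have hcoef := sum_norm_sq_div_le_of_dom_tau_two hdom hP2
  have hlog4 : Real.log (⌊bigP D⌋₊ : ℝ) ^ 4 ≤ ell D ^ 36 := by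
    have h0 : 0 ≤ Real.log (⌊bigP D⌋₊ : ℝ) := Real.log_nonneg (by exact_mod_cast (by omega : 1 ≤ ⌊bigP D⌋₊))
    calc Real.log (⌊bigP D⌋₊ : ℝ) ^ 4 ≤ (ell D ^ 9) ^ 4 := pow_le_pow_left₀ h0 hlogP 4
      _ = ell D ^ 36 := by ring
  have hmc := (majorantConst_pos 4 4).le
  calc ∑ x ∈ T, ‖Bpoly χ x s‖ ^ 2
      = ∑ x ∈ T, ‖∑ n ∈ Icc 1 ⌊bigP D⌋₊,
          (fun n => if n < NB then bcoef D n * χ (n : ZMod D) else 0) n * x.ψ (n : ZMod x.p) *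
            (n : ℂ) ^ (-s)‖ ^ 2 := Finset.sum_congr rfl fun x _ => by rw [hB x]
    _ ≤ Real.exp (8 * π) * frakP D * ∑ n ∈ Icc 1 ⌊bigP D⌋₊,
          ‖(fun n => if n < NB then bcoef D n * χ (n : ZMod D) else 0) n‖ ^ 2 / n :=
        meanSq_floorP_le hL1 T hs _
    _ ≤ Real.exp (8 * π) * frakP D * (β ^ 2 * (majorantConst 4 4 * Real.log (⌊bigP D⌋₊ : ℝ) ^ 4)) :=
        mul_le_mul_of_nonneg_left hcoef (by positivity)
    _ ≤ Real.exp (8 * π) * frakP D * (β ^ 2 * (majorantConst 4 4 * ell D ^ 36)) := by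
        apply mul_le_mul_of_nonneg_left _ (by positivity)
        exact mul_le_mul_of_nonneg_left (mul_le_mul_of_nonneg_left hlog4 hmc) (sq_nonneg _)
    _ = _ := by ring

/-- **The mean square of `(short factor)·B`** — the common step behind `N·B` and `(E₁-poly)·B`: for
`𝓛 ≥ 4`, `|Re s − ½| ≤ 2α`, `Re β = 0`, `|g| ≤ 1`, a length `M` with `(M−1)(⌈PT⁻⁷⌉−1) ≤ ⌊P⌋`, `2 ≤ M` and
`log M ≤ c𝓛²`: `Σ_{ψ∈T} |(Σ_{1≤n<M} g(n)n^{−β}ψ(n)n^{−s})·B(s,ψ)|² ≤ e^{8π}β²·mC₉₆·c⁵·𝔓·𝓛⁴⁶`.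
[cite: Zhang2022LandauSiegel, §13 p.75; §3 Lemma 3.3; §15 (15.2)] -/
theorem meanSq_short_Bpoly_frakP_le [NeZero D] (χ : DirichletCharacter ℂ D) (hL : 4 ≤ ell D)
    (T : Finset (Chr D)) {s β : ℂ} (hs : |s.re - 1 / 2| ≤ 2 * alpha D) (hβ : β.re = 0)
    {g : ℕ → ℂ} (hg : ∀ n, ‖g n‖ ≤ 1) {M : ℕ} (hM2 : 2 ≤ M)
    (hMlen : (M - 1) * (⌈bigP D / bigT D ^ 7⌉₊ - 1) ≤ ⌊bigP D⌋₊) {c : ℝ} (hlogM : Real.log M ≤ c * ell D ^ 2) :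
    ∑ x ∈ T, ‖(∑ n ∈ Ico 1 M, (g n * (n : ℂ) ^ (-β)) * x.ψ (n : ZMod x.p) * (n : ℂ) ^ (-s)) *
        Bpoly χ x s‖ ^ 2 ≤
      Real.exp (8 * π) * (((1 + ‖iota2‖) * (‖iota3‖ + ‖iota4‖)) ^ 2 * majorantConst 9 6 * c ^ 5) *
        frakP D * ell D ^ 46 := by
  have hL1 : 1 ≤ ell D := by linarith
  have hL0 : 0 ≤ ell D := by linarith
  obtain ⟨-, ⟨-, -, hlogP⟩, -, -⟩ := lengths_of_four_le_ell hL
  obtain ⟨-, -, -, hP2⟩ := sizes_of_four_le_ell hL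
  set NB := ⌈bigP D / bigT D ^ 7⌉₊ with hNB
  set βc : ℝ := (1 + ‖iota2‖) * (‖iota3‖ + ‖iota4‖) with hβc
  have hP : 0 ≤ frakP D := by
    rw [frakP_eq_sum_primeWindow]; exact Finset.sum_nonneg fun p _ => Nat.cast_nonneg p
  set u' : ℕ → ℂ := fun n => if n < M then g n * (n : ℂ) ^ (-β) else 0 with hu'
  set v' : ℕ → ℂ := fun n => if n < NB then bcoef D n * χ (n : ZMod D) else 0 with hv'
  -- the product as ONE polynomial over `1 ≤ k ≤ ⌊P⌋`
  have hprod : ∀ x : Chr D,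
      (∑ n ∈ Ico 1 M, (g n * (n : ℂ) ^ (-β)) * x.ψ (n : ZMod x.p) * (n : ℂ) ^ (-s)) * Bpoly χ x s =
        ∑ k ∈ Icc 1 ⌊bigP D⌋₊, seqConv u' v' k * x.ψ (k : ZMod x.p) * (k : ℂ) ^ (-s) := by
    intro x
    rw [Bpoly_eq_dirPoly χ hL x s]
    exact dirPoly_mul_dirPoly_eq M NB ⌊bigP D⌋₊ hMlen _ _ _ (psi_natCast_mul x).1 s
  -- the coefficients
  have hu : Dom u' 1 (smoothIndLE M) := dom_trunc_unimodular hg hβ M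
  have hv : Dom v' βc (tau 2) :=
    dom_trunc_of_dom (dom_bcoef_chi χ (by change 2 ≤ ell D; linarith)) (by positivity) (tau_nonneg 2) NB
  have hcoef := sum_norm_seqConv_short_bcoef_sq_div_le hu hv hM2 hP2
  rw [one_mul] at hcoef
  -- the logarithms
  have hc0 : 0 ≤ c := by
    have : 0 ≤ Real.log M := Real.log_nonneg (by exact_mod_cast (by omega : 1 ≤ M))
    nlinarith [pow_pos (show 0 < ell D by linarith) 2]
  have hlog4 : Real.log (⌊bigP D⌋₊ : ℝ) ^ 4 ≤ ell D ^ 36 := by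
    have h0 : 0 ≤ Real.log (⌊bigP D⌋₊ : ℝ) := Real.log_nonneg (by exact_mod_cast (by omega : 1 ≤ ⌊bigP D⌋₊))
    calc Real.log (⌊bigP D⌋₊ : ℝ) ^ 4 ≤ (ell D ^ 9) ^ 4 := pow_le_pow_left₀ h0 hlogP 4
      _ = ell D ^ 36 := by ring
  have hlog5 : Real.log (M : ℝ) ^ 5 ≤ c ^ 5 * ell D ^ 10 := by
    have h0 : 0 ≤ Real.log (M : ℝ) := Real.log_nonneg (by exact_mod_cast (by omega : 1 ≤ M))
    calc Real.log (M : ℝ) ^ 5 ≤ (c * ell D ^ 2) ^ 5 := pow_le_pow_left₀ h0 hlogM 5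
      _ = c ^ 5 * ell D ^ 10 := by ring
  have hlogs : Real.log (⌊bigP D⌋₊ : ℝ) ^ 4 * Real.log (M : ℝ) ^ 5 ≤ ell D ^ 36 * (c ^ 5 * ell D ^ 10) :=
    mul_le_mul hlog4 hlog5 (by positivity) (by positivity)
  have hmc := (majorantConst_pos 9 6).le
  calc ∑ x ∈ T, ‖(∑ n ∈ Ico 1 M, (g n * (n : ℂ) ^ (-β)) * x.ψ (n : ZMod x.p) * (n : ℂ) ^ (-s)) *
        Bpoly χ x s‖ ^ 2
      = ∑ x ∈ T, ‖∑ k ∈ Icc 1 ⌊bigP D⌋₊, seqConv u' v' k * x.ψ (k : ZMod x.p) * (k : ℂ) ^ (-s)‖ ^ 2 :=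
        Finset.sum_congr rfl fun x _ => by rw [hprod x]
    _ ≤ Real.exp (8 * π) * frakP D * ∑ k ∈ Icc 1 ⌊bigP D⌋₊, ‖seqConv u' v' k‖ ^ 2 / k :=
        meanSq_floorP_le hL1 T hs _
    _ ≤ Real.exp (8 * π) * frakP D *
          (βc ^ 2 * (majorantConst 9 6 * (Real.log (⌊bigP D⌋₊ : ℝ) ^ 4 * Real.log (M : ℝ) ^ 5))) :=
        mul_le_mul_of_nonneg_left hcoef (by positivity)
    _ ≤ Real.exp (8 * π) * frakP D * (βc ^ 2 * (majorantConst 9 6 * (ell D ^ 36 * (c ^ 5 * ell D ^ 10)))) := by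
        apply mul_le_mul_of_nonneg_left _ (by positivity)
        exact mul_le_mul_of_nonneg_left (mul_le_mul_of_nonneg_left hlogs hmc) (sq_nonneg _)
    _ = _ := by ring

/-- **`Σ_{ψ∈T} |N(s+β,ψ)B(s,ψ)|² ≤ C·𝔓·𝓛⁴⁶`** on `|Re s − ½| ≤ 2α`, `Re β = 0` (e.g. `β = β_j`), all large
`D`, every finite `T ⊆ Ψ` (length `2T²·PT⁻⁷ ≤ P`: Lemma 3.3 (i)). [cite: Zhang2022LandauSiegel, §13 p.75; §6 Lemma 6.1] -/
theorem meanSq_Nchar_Bpoly_frakP_le : ∃ C : ℝ, ∃ D₀ : ℕ, ∀ (D : ℕ) [NeZero D] (χ : DirichletCharacter ℂ D),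
    D₀ ≤ D → ∀ (T : Finset (Chr D)) (s β : ℂ), |s.re - 1 / 2| ≤ 2 * alpha D → β.re = 0 →
      ∑ x ∈ T, ‖Nchar D (psiFn x) (s + β) * Bpoly χ x s‖ ^ 2 ≤ C * frakP D * ell D ^ 46 := by
  obtain ⟨D₁, hD₁⟩ := Filter.eventually_atTop.mp (tendsto_ell_atTop.eventually (eventually_ge_atTop 4))
  refine ⟨Real.exp (8 * π) * (((1 + ‖iota2‖) * (‖iota3‖ + ‖iota4‖)) ^ 2 * majorantConst 9 6 * 3 ^ 5),
    D₁, fun D _ χ hD T s β hs hβ => ?_⟩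
  have hL : 4 ≤ ell D := hD₁ D hD
  obtain ⟨⟨hM2, -⟩, ⟨hlogM, -, -⟩, ⟨hlen, -, -⟩, -⟩ := lengths_of_four_le_ell hL
  have h := meanSq_short_Bpoly_frakP_le χ hL T hs hβ (g := fun n => (gstar D (bigT D ^ 2 / n) : ℂ))
    (fun n => norm_gstar_le_one (by linarith) _) hM2 hlen hlogM
  simpa only [Nchar_shift_eq_dirPoly] using h

/-- **`Σ_{ψ∈T} |(Σ_{n<T³}ψ(n)n^{−(s+β)})·B(s,ψ)|² ≤ C·𝔓·𝓛⁴⁶`** on `|Re s − ½| ≤ 2α`, `Re β = 0` (e.g.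
`β = β_j + iv`, the `E₁`-polynomial at `ρ + β_j + iv`), all large `D`, every finite `T ⊆ Ψ` (length
`T³·PT⁻⁷ ≤ P`). [cite: Zhang2022LandauSiegel, §13 p.75; §6 Lemma 6.1] -/
theorem meanSq_E1poly_Bpoly_frakP_le : ∃ C : ℝ, ∃ D₀ : ℕ, ∀ (D : ℕ) [NeZero D] (χ : DirichletCharacter ℂ D),
    D₀ ≤ D → ∀ (T : Finset (Chr D)) (s β : ℂ), |s.re - 1 / 2| ≤ 2 * alpha D → β.re = 0 →
      ∑ x ∈ T, ‖(∑ n ∈ Ico 1 ⌈bigT D ^ 3⌉₊, x.ψ (n : ZMod x.p) * (n : ℂ) ^ (-(s + β))) *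
          Bpoly χ x s‖ ^ 2 ≤ C * frakP D * ell D ^ 46 := by
  obtain ⟨D₁, hD₁⟩ := Filter.eventually_atTop.mp (tendsto_ell_atTop.eventually (eventually_ge_atTop 4))
  refine ⟨Real.exp (8 * π) * (((1 + ‖iota2‖) * (‖iota3‖ + ‖iota4‖)) ^ 2 * majorantConst 9 6 * 4 ^ 5),
    D₁, fun D _ χ hD T s β hs hβ => ?_⟩
  have hL : 4 ≤ ell D := hD₁ D hD
  obtain ⟨⟨-, hM2⟩, ⟨-, hlogM, -⟩, ⟨-, hlen, -⟩, -⟩ := lengths_of_four_le_ell hL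
  have h := meanSq_short_Bpoly_frakP_le χ hL T hs hβ (g := fun _ => (1 : ℂ)) (fun n => by simp) hM2 hlen hlogM
  simpa only [E1poly_shift_eq_dirPoly] using h

/-- **`Σ_{ψ∈T} |N(s+β,ψ)N(s+β′,ψ)|² ≤ C·𝔓·𝓛⁸`** on `|Re s − ½| ≤ 2α`, `Re β = Re β′ = 0`, all large `D`
(length `4T⁴ ≤ P`; coefficients `≪ 1_{T²} ⋆ 1_{T²}`, count `(log 2T²)⁴ ≪ 𝓛⁸`). [cite: Zhang2022LandauSiegel, §13 p.75; §6 Lemma 6.1] -/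
theorem meanSq_Nchar_Nchar_frakP_le : ∃ C : ℝ, ∃ D₀ : ℕ, ∀ D : ℕ, D₀ ≤ D →
    ∀ (T : Finset (Chr D)) (s β β' : ℂ), |s.re - 1 / 2| ≤ 2 * alpha D → β.re = 0 → β'.re = 0 →
      ∑ x ∈ T, ‖Nchar D (psiFn x) (s + β) * Nchar D (psiFn x) (s + β')‖ ^ 2 ≤
        C * frakP D * ell D ^ 8 := by
  obtain ⟨D₁, hD₁⟩ := Filter.eventually_atTop.mp (tendsto_ell_atTop.eventually (eventually_ge_atTop 4))
  refine ⟨Real.exp (8 * π) * (majorantConst 4 2 * 3 ^ 4), D₁, fun D hD T s β β' hs hβ hβ' => ?_⟩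
  have hL : 4 ≤ ell D := hD₁ D hD
  have hL1 : 1 ≤ ell D := by linarith
  have hℓ : 0 < ell D := by linarith
  obtain ⟨⟨hM2, -⟩, ⟨hlogM, -, -⟩, ⟨-, -, hlen⟩, -⟩ := lengths_of_four_le_ell hL
  obtain ⟨-, -, -, hP2⟩ := sizes_of_four_le_ell hL
  set M := ⌈2 * bigT D ^ 2⌉₊ with hM
  have hP : 0 ≤ frakP D := by
    rw [frakP_eq_sum_primeWindow]; exact Finset.sum_nonneg fun p _ => Nat.cast_nonneg p
  set u' : ℕ → ℂ := fun n => if n < M then (gstar D (bigT D ^ 2 / n) : ℂ) * (n : ℂ) ^ (-β) else 0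
  set v' : ℕ → ℂ := fun n => if n < M then (gstar D (bigT D ^ 2 / n) : ℂ) * (n : ℂ) ^ (-β') else 0
  have hprod : ∀ x : Chr D, Nchar D (psiFn x) (s + β) * Nchar D (psiFn x) (s + β') =
      ∑ k ∈ Icc 1 ⌊bigP D⌋₊, seqConv u' v' k * x.ψ (k : ZMod x.p) * (k : ℂ) ^ (-s) := by
    intro x
    rw [Nchar_shift_eq_dirPoly x s β, Nchar_shift_eq_dirPoly x s β']
    exact dirPoly_mul_dirPoly_eq M M ⌊bigP D⌋₊ hlen _ _ _ (psi_natCast_mul x).1 s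
  have hu : Dom u' 1 (smoothIndLE M) := dom_trunc_unimodular (fun n => norm_gstar_le_one hℓ _) hβ M
  have hv : Dom v' 1 (smoothIndLE M) := dom_trunc_unimodular (fun n => norm_gstar_le_one hℓ _) hβ' M
  have hcoef := sum_norm_seqConv_short_short_sq_div_le hu hv hM2 hP2
  have hlog4 : Real.log (M : ℝ) ^ 4 ≤ 3 ^ 4 * ell D ^ 8 := by
    have h0 : 0 ≤ Real.log (M : ℝ) := Real.log_nonneg (by exact_mod_cast (by omega : 1 ≤ M))
    calc Real.log (M : ℝ) ^ 4 ≤ (3 * ell D ^ 2) ^ 4 := pow_le_pow_left₀ h0 hlogM 4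
      _ = 3 ^ 4 * ell D ^ 8 := by ring
  have hmc := (majorantConst_pos 4 2).le
  calc ∑ x ∈ T, ‖Nchar D (psiFn x) (s + β) * Nchar D (psiFn x) (s + β')‖ ^ 2
      = ∑ x ∈ T, ‖∑ k ∈ Icc 1 ⌊bigP D⌋₊, seqConv u' v' k * x.ψ (k : ZMod x.p) * (k : ℂ) ^ (-s)‖ ^ 2 :=
        Finset.sum_congr rfl fun x _ => by rw [hprod x]
    _ ≤ Real.exp (8 * π) * frakP D * ∑ k ∈ Icc 1 ⌊bigP D⌋₊, ‖seqConv u' v' k‖ ^ 2 / k :=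
        meanSq_floorP_le hL1 T hs _
    _ ≤ Real.exp (8 * π) * frakP D * (majorantConst 4 2 * Real.log (M : ℝ) ^ 4) :=
        mul_le_mul_of_nonneg_left hcoef (by positivity)
    _ ≤ Real.exp (8 * π) * frakP D * (majorantConst 4 2 * (3 ^ 4 * ell D ^ 8)) :=
        mul_le_mul_of_nonneg_left (mul_le_mul_of_nonneg_left hlog4 hmc) (by positivity)
    _ = _ := by ring

/-- **The mean square of one short factor**: for `𝓛 ≥ 1`, `|Re s − ½| ≤ 2α`, `Re β = 0`, `|g| ≤ 1` and a
length `M` with `M − 1 ≤ ⌊P⌋`: `Σ_{ψ∈T} |Σ_{1≤n<M} g(n)n^{−β}ψ(n)n^{−s}|² ≤ e^{8π}·𝔓·(1 + log⌊P⌋)` … here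
with the sharper count `1 + log M'` replaced by the harmonic bound over `k ≤ M − 1`:
`≤ e^{8π}·𝔓·(1 + log(M−1))`. [cite: Zhang2022LandauSiegel, §13 p.75; §3 Lemma 3.3] -/
theorem meanSq_short_frakP_le (hL : 1 ≤ ell D) (T : Finset (Chr D)) {s β : ℂ}
    (hs : |s.re - 1 / 2| ≤ 2 * alpha D) (hβ : β.re = 0) {g : ℕ → ℂ} (hg : ∀ n, ‖g n‖ ≤ 1) {M : ℕ}
    (hMlen : M - 1 ≤ ⌊bigP D⌋₊) :
    ∑ x ∈ T, ‖∑ n ∈ Ico 1 M, (g n * (n : ℂ) ^ (-β)) * x.ψ (n : ZMod x.p) * (n : ℂ) ^ (-s)‖ ^ 2 ≤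
      Real.exp (8 * π) * frakP D * (1 + Real.log ((M - 1 : ℕ) : ℝ)) := by
  have hP : 0 ≤ frakP D := by
    rw [frakP_eq_sum_primeWindow]; exact Finset.sum_nonneg fun p _ => Nat.cast_nonneg p
  set u' : ℕ → ℂ := fun n => if n < M then g n * (n : ℂ) ^ (-β) else 0 with hu'
  have hpoly : ∀ x : Chr D, ∑ n ∈ Ico 1 M, (g n * (n : ℂ) ^ (-β)) * x.ψ (n : ZMod x.p) * (n : ℂ) ^ (-s) =
      ∑ n ∈ Icc 1 ⌊bigP D⌋₊, u' n * x.ψ (n : ZMod x.p) * (n : ℂ) ^ (-s) := fun x =>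
    sum_Ico_eq_sum_Icc_trunc hMlen _ _ s
  have hu1 : ∀ n, ‖u' n‖ ≤ 1 := by
    intro n
    simp only [hu']
    split_ifs with h
    · rcases Nat.eq_zero_or_pos n with rfl | hn
      · have : (0 : ℂ) ^ (-β) = 0 ∨ (0 : ℂ) ^ (-β) = 1 := by
          by_cases hb : -β = 0
          · right; rw [hb, Complex.cpow_zero]
          · left; exact Complex.zero_cpow hb
        rcases this with h0 | h0 <;> rw [Nat.cast_zero, h0]
        · simp
        · rw [mul_one]; exact hg 0
      · rw [norm_mul, norm_natCast_cpow_neg_of_re_zero hn.ne' hβ, mul_one]; exact hg n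
    · simp
  -- the coefficient sum lives on `k ≤ M − 1`
  have hsupp : ∑ n ∈ Icc 1 ⌊bigP D⌋₊, ‖u' n‖ ^ 2 / n = ∑ n ∈ Icc 1 (M - 1), ‖u' n‖ ^ 2 / n := by
    symm
    refine Finset.sum_subset (fun n hn => ?_) (fun n hn hn' => ?_)
    · rw [Finset.mem_Icc] at hn ⊢; exact ⟨hn.1, hn.2.trans hMlen⟩
    · rw [Finset.mem_Icc] at hn
      rw [Finset.mem_Icc, not_and, not_le] at hn'
      have : ¬ n < M := by have := hn' hn.1; omega
      simp [hu', this]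
  calc ∑ x ∈ T, ‖∑ n ∈ Ico 1 M, (g n * (n : ℂ) ^ (-β)) * x.ψ (n : ZMod x.p) * (n : ℂ) ^ (-s)‖ ^ 2
      = ∑ x ∈ T, ‖∑ n ∈ Icc 1 ⌊bigP D⌋₊, u' n * x.ψ (n : ZMod x.p) * (n : ℂ) ^ (-s)‖ ^ 2 :=
        Finset.sum_congr rfl fun x _ => by rw [hpoly x]
    _ ≤ Real.exp (8 * π) * frakP D * ∑ n ∈ Icc 1 ⌊bigP D⌋₊, ‖u' n‖ ^ 2 / n :=
        meanSq_floorP_le hL T hs _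
    _ = Real.exp (8 * π) * frakP D * ∑ n ∈ Icc 1 (M - 1), ‖u' n‖ ^ 2 / n := by rw [hsupp]
    _ ≤ Real.exp (8 * π) * frakP D * (1 + Real.log ((M - 1 : ℕ) : ℝ)) :=
        mul_le_mul_of_nonneg_left (sum_norm_sq_div_le_one_add_log hu1 (M - 1)) (by positivity)

/-- **`Σ_{ψ∈T} |N(s+β,ψ)|² ≤ C·𝔓·𝓛²`** and **`Σ_{ψ∈T} |Σ_{n<T³}ψ(n)n^{−(s+β)}|² ≤ C·𝔓·𝓛²`** on
`|Re s − ½| ≤ 2α`, `Re β = 0`, all large `D` (lengths `2T², T³ ≤ P`; `1 + log T³ ≤ 5𝓛²`).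
[cite: Zhang2022LandauSiegel, §13 p.75; §6 Lemma 6.1] -/
theorem meanSq_Nchar_E1poly_frakP_le : ∃ C : ℝ, ∃ D₀ : ℕ, ∀ D : ℕ, D₀ ≤ D →
    ∀ (T : Finset (Chr D)) (s β : ℂ), |s.re - 1 / 2| ≤ 2 * alpha D → β.re = 0 →
      ∑ x ∈ T, ‖Nchar D (psiFn x) (s + β)‖ ^ 2 ≤ C * frakP D * ell D ^ 2 ∧
      ∑ x ∈ T, ‖∑ n ∈ Ico 1 ⌈bigT D ^ 3⌉₊, x.ψ (n : ZMod x.p) * (n : ℂ) ^ (-(s + β))‖ ^ 2 ≤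
        C * frakP D * ell D ^ 2 := by
  obtain ⟨D₁, hD₁⟩ := Filter.eventually_atTop.mp (tendsto_ell_atTop.eventually (eventually_ge_atTop 4))
  refine ⟨Real.exp (8 * π) * 5, D₁, fun D hD T s β hs hβ => ?_⟩
  have hL : 4 ≤ ell D := hD₁ D hD
  have hL1 : 1 ≤ ell D := by linarith
  have hℓ : 0 < ell D := by linarith
  obtain ⟨⟨hM2, hM2'⟩, ⟨hlogM, hlogM', -⟩, -, ⟨hlen, hlen', -⟩⟩ := lengths_of_four_le_ell hL
  have hP : 0 ≤ frakP D := by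
    rw [frakP_eq_sum_primeWindow]; exact Finset.sum_nonneg fun p _ => Nat.cast_nonneg p
  -- `1 + log(M − 1) ≤ 1 + log M ≤ 5𝓛²` for both lengths
  have hlg : ∀ {M : ℕ} {c : ℝ}, 2 ≤ M → Real.log (M : ℝ) ≤ c * ell D ^ 2 → c ≤ 4 →
      1 + Real.log ((M - 1 : ℕ) : ℝ) ≤ 5 * ell D ^ 2 := by
    intro M c hM hlog hc
    have h1 : Real.log ((M - 1 : ℕ) : ℝ) ≤ Real.log (M : ℝ) :=
      Real.log_le_log (by exact_mod_cast (by omega : 0 < M - 1)) (by exact_mod_cast Nat.sub_le M 1)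
    have h2 : (1 : ℝ) ≤ ell D ^ 2 := by nlinarith
    nlinarith [pow_nonneg hℓ.le 2]
  constructor
  · have h := meanSq_short_frakP_le hL1 T hs hβ (g := fun n => (gstar D (bigT D ^ 2 / n) : ℂ))
      (fun n => norm_gstar_le_one hℓ _) hlen
    simp_rw [← Nchar_shift_eq_dirPoly] at h
    calc _ ≤ Real.exp (8 * π) * frakP D * (1 + Real.log ((⌈2 * bigT D ^ 2⌉₊ - 1 : ℕ) : ℝ)) := h
      _ ≤ Real.exp (8 * π) * frakP D * (5 * ell D ^ 2) :=
          mul_le_mul_of_nonneg_left (hlg hM2 hlogM (by norm_num)) (by positivity)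
      _ = _ := by ring
  · have h := meanSq_short_frakP_le hL1 T hs hβ (g := fun _ => (1 : ℂ)) (fun n => by simp) hlen'
    simp_rw [← E1poly_shift_eq_dirPoly] at h
    calc _ ≤ Real.exp (8 * π) * frakP D * (1 + Real.log ((⌈bigT D ^ 3⌉₊ - 1 : ℕ) : ℝ)) := h
      _ ≤ Real.exp (8 * π) * frakP D * (5 * ell D ^ 2) :=
          mul_le_mul_of_nonneg_left (hlg hM2' hlogM' (by norm_num)) (by positivity)
      _ = _ := by ring

/-- **`Σ_{ψ∈T} |K(s+β,ψ)|² ≤ C·𝔓·𝓛⁹`** on `|Re s − ½| ≤ 2α`, `Re β = 0`, all large `D` (length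
`2P₄ ≤ P` once `2t₀ ≤ T²`; `1 + log 2P₄ ≤ 2𝓛⁹`). [cite: Zhang2022LandauSiegel, §13 p.75; §6 Lemma 6.1] -/
theorem meanSq_Kchar_frakP_le : ∃ C : ℝ, ∃ D₀ : ℕ, ∀ D : ℕ, D₀ ≤ D →
    ∀ (T : Finset (Chr D)) (s β : ℂ), |s.re - 1 / 2| ≤ 2 * alpha D → β.re = 0 →
      ∑ x ∈ T, ‖Kchar D (psiFn x) (s + β)‖ ^ 2 ≤ C * frakP D * ell D ^ 9 := by
  obtain ⟨D₁, hD₁⟩ := Filter.eventually_atTop.mp (tendsto_ell_atTop.eventually (eventually_ge_atTop 4))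
  obtain ⟨D₂, hD₂⟩ := eventually_two_t0_le_Tsq
  refine ⟨Real.exp (8 * π) * 2, max D₁ D₂, fun D hD T s β hs hβ => ?_⟩
  have hL : 4 ≤ ell D := hD₁ D (le_trans (le_max_left _ _) hD)
  have ht0T : 2 * t0 D ≤ bigT D ^ 2 := hD₂ D (le_trans (le_max_right _ _) hD)
  have hL1 : 1 ≤ ell D := by linarith
  have hℓ : 0 < ell D := by linarith
  have hP0 : 0 < bigP D := Real.exp_pos _
  have hP : 0 ≤ frakP D := by
    rw [frakP_eq_sum_primeWindow]; exact Finset.sum_nonneg fun p _ => Nat.cast_nonneg p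
  have hP4 : 0 ≤ 2 * P4 D := by unfold P4 t0; positivity
  have hP4' : 2 * P4 D ≤ bigP D := by
    have hT : 0 < bigT D ^ 2 := pow_pos (Real.exp_pos _) 2
    rw [show 2 * P4 D = bigP D * (2 * t0 D / bigT D ^ 2) by unfold P4; ring]
    exact mul_le_of_le_one_right hP0.le ((div_le_one hT).mpr ht0T)
  have hlen : ⌈2 * P4 D⌉₊ - 1 ≤ ⌊bigP D⌋₊ := ceil_sub_one_le_floor hP4 hP4'
  have h := meanSq_short_frakP_le hL1 T hs hβ (g := fun n => (gstar D (P4 D / n) : ℂ))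
    (fun n => norm_gstar_le_one hℓ _) hlen
  simp_rw [← Kchar_shift_eq_dirPoly] at h
  have hlog : 1 + Real.log ((⌈2 * P4 D⌉₊ - 1 : ℕ) : ℝ) ≤ 2 * ell D ^ 9 := by
    have h9 : (1 : ℝ) ≤ ell D ^ 9 := one_le_pow₀ hL1
    rcases Nat.eq_zero_or_pos (⌈2 * P4 D⌉₊ - 1) with h0 | hpos
    · rw [h0]; simp; linarith
    · have h1 : Real.log ((⌈2 * P4 D⌉₊ - 1 : ℕ) : ℝ) ≤ Real.log (bigP D) :=
        Real.log_le_log (by exact_mod_cast hpos) ((cast_ceil_sub_one_le hP4).trans hP4')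
      rw [bigP, Real.log_exp] at h1
      linarith
  calc _ ≤ Real.exp (8 * π) * frakP D * (1 + Real.log ((⌈2 * P4 D⌉₊ - 1 : ℕ) : ℝ)) := h
    _ ≤ Real.exp (8 * π) * frakP D * (2 * ell D ^ 9) := mul_le_mul_of_nonneg_left hlog (by positivity)
    _ = _ := by ring

end Literature.NumberTheory.LFunctions.Zhang2022.Typed.Section13
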